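import Summits.AtomisticToContinuum.Crystallization.Theorems.FreeSplittingCertificatesStrictSplittingRuleGroundStateHardy
import Summits.AtomisticToContinuum.Crystallization.Theorems.FreeSplittingCertificatesStrictSplittingRuleHcpHardyWeight

/-!
# `StrictSplittingRule` (stmt-AtomisticToContinuum-12560): the discrete weighted Hardy inequality on the hcp exterior

Route `FreeSplittingCertificates`, crux r3 `StrictSplittingRule`, line `registered` (unit b2b-freesplit-B, gen 6).
Fifth brick of the far lemma of the H12⋆ architecture (HOME CERT.md §14 (3), §15): the HARDY HALF assembled.  With the
receipts of an `r⁻⁶` import family as currency — site `x` contributes `c₆‖y_x‖⁻⁶` times the squared differences over its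
twelve first-shell bonds — every scalar lattice field `f` supported on sites where the radial margin `κ(a,h,‖y_x‖)` of
`…HcpHardyWeight.lean` is at least `κ₀` satisfies
`κ₀ · Σ_x ‖y_x‖⁻⁸ f(x)² ≤ Σ_x ‖y_x‖⁻⁶ Σ_{s ∈ shell} (f(x_s) − f(x))²`
(`x_s` = the neighbour of `x` with label `s`: index `x + s` on even layers, `x − s` on odd layers, `h1_sub_eq`), and the
same for `ℝ³`-valued fields.  Ingredients: the ground-state inequality `…GroundStateHardy.groundState_edge_le` bond by bond
with the quadratic profile `φ = ‖y‖²`, the discrete summation by parts over ORIENTED bonds — the map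
`(x, s) ↦ (x_s, τ s)`, `τ` = negate the in-layer labels / keep the off-layer labels, is an involution pairing every oriented
bond with its reverse (`hcpBond_invol`) — and the supersolution margin `hcpHardyWeight_margin` at `z = ± y_x`.

* `hcpStar_tau_mem`, `hcpStar_tau_tau`, `hcpBond_invol` — label bookkeeping of reversed bonds;
* `hcpBond_norm_sq` — `‖y_{x_s}‖² = ‖± y_x + y_s‖²` (sign = layer parity of `x`);
* `hcpSite_laplacian_ge` — `Σ_s (‖y_x‖⁻⁶ + ‖y_{x_s}‖⁻⁶)(‖y_x‖² − ‖y_{x_s}‖²) ≥ ‖y_x‖⁻⁶ κ(a,h,‖y_x‖)` at every site `x ≠ 0`;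
* `hcpExterior_hardy` (scalar) and `hcpExterior_hardy_vec` (`ℝ³`-valued); the radial forms (`κ(R)` for fields supported on
  `{‖y‖ ≥ R}`, the margin being nondecreasing in `r`) are in the companion file `…HcpExteriorHardyRadial.lean`.

The far lemma uses it with `κ₀ > 0` on `{‖y‖ ≥ 4a}` (ideal hcp: `κ(4a) ≈ 4.5a²`, `κ(6a) ≈ 14.6a²`; float truth `≥ 23a²` from
`2a` on, the inner shells being a finite rational check) to charge the bare `r⁻⁸` radial deficit of far bonds to `r⁻⁶`
receipts (numerically 2.9 % of the compact table's receipts, CERT §15).  Structural bookkeeping ([folklore]); VALUE = a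
kernel-checked brick — NOT summit progress.
-/

noncomputable section

namespace Summit.AtomisticToContinuum.Crystallization.Theorems.StrictSplittingRuleBirth

open scoped BigOperators
open Literature.MathematicalPhysics.StatisticalMechanics
open Summit.AtomisticToContinuum.Crystallization.Theorems.PalmUnimodularRigidity.LayeredLawsSelectHcp

/-! ## Label bookkeeping -/

/-- The layer components of the shell labels are `0` (six in-layer) or `±1` (six off-layer). [folklore] -/
theorem hcpStar_fst {s : ℤ × ℤ × ℤ} (hs : s ∈ hcpStarIdx) : s.1 = 0 ∨ s.1 = 1 ∨ s.1 = -1 := by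
  simp only [hcpStarIdx, Finset.mem_insert, Finset.mem_singleton] at hs
  rcases hs with rfl | rfl | rfl | rfl | rfl | rfl | rfl | rfl | rfl | rfl | rfl | rfl <;> decide

/-- The reverse-bond label `τ s` (negate in-layer labels, keep off-layer ones) is a shell label. [folklore] -/
theorem hcpStar_tau_mem {s : ℤ × ℤ × ℤ} (hs : s ∈ hcpStarIdx) : (if s.1 = 0 then -s else s) ∈ hcpStarIdx := by
  simp only [hcpStarIdx, Finset.mem_insert, Finset.mem_singleton] at hs ⊢
  rcases hs with rfl | rfl | rfl | rfl | rfl | rfl | rfl | rfl | rfl | rfl | rfl | rfl <;> decide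

/-- `τ` is an involution. [folklore] -/
theorem hcpStar_tau_tau (s : ℤ × ℤ × ℤ) :
    (if (if s.1 = 0 then -s else s).1 = 0 then -(if s.1 = 0 then -s else s) else (if s.1 = 0 then -s else s)) = s := by
  by_cases h0 : s.1 = 0
  · simp [h0]
  · simp [h0]

/-- **Reversed bonds.**  With `x_s := x + (±s)` (sign `+` on even layers), stepping from `x_s` with the label `τ s` returns
to `x`. [folklore] -/
theorem hcpBond_invol (x : ℤ × ℤ × ℤ) {s : ℤ × ℤ × ℤ} (hs : s ∈ hcpStarIdx) :
    (x + (if Even x.1 then s else -s)) +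
        (if Even (x + (if Even x.1 then s else -s)).1 then (if s.1 = 0 then -s else s)
          else -(if s.1 = 0 then -s else s)) = x := by
  rcases hcpStar_fst hs with h0 | h1 | h1
  · -- in-layer: parity preserved, reverse label −s
    by_cases hx : Even x.1
    · simp [hx, h0]
    · simp [hx, h0]
  · -- off-layer, s.1 = 1: parity flips, reverse label s
    have hne : s.1 ≠ 0 := by rw [h1]; decide
    by_cases hx : Even x.1
    · have h' : ¬Even (x.1 + s.1) := by rw [h1, Int.even_add_one, not_not]; exact hx
      simp [hx, hne, h']
    · have h' : Even (x.1 + -s.1) := by rw [h1, ← sub_eq_add_neg, Int.even_sub_one]; exact hx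
      simp [hx, hne, h']
  · -- off-layer, s.1 = -1
    have hne : s.1 ≠ 0 := by rw [h1]; decide
    by_cases hx : Even x.1
    · have h' : ¬Even (x.1 + s.1) := by rw [h1, ← sub_eq_add_neg, Int.even_sub_one, not_not]; exact hx
      simp [hx, hne, h']
    · have h' : Even (x.1 + -s.1) := by rw [h1, neg_neg, Int.even_add_one]; exact hx
      simp [hx, hne, h']

/-- **Bond geometry**: `‖y_{x_s}‖² = ‖y_x + y_s‖²` on even layers, `‖−y_x + y_s‖²` on odd layers (`h1_sub_eq`). [folklore] -/
theorem hcpBond_norm_sq (a h : ℝ) (x s : ℤ × ℤ × ℤ) :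
    ‖hcpSite a h (x + (if Even x.1 then s else -s))‖ ^ 2 =
      ‖(if Even x.1 then hcpSite a h x else -hcpSite a h x) + hcpSite a h s‖ ^ 2 := by
  have key := h1_sub_eq a h x (if Even x.1 then s else -s)
  by_cases hx : Even x.1
  · simp only [hx, if_true] at key ⊢
    rw [sub_eq_iff_eq_add'] at key
    rw [key]
  · simp only [hx, if_false, neg_neg] at key ⊢
    rw [sub_eq_iff_eq_add'] at key
    rw [key, ← norm_neg]
    congr 1
    abel

/-- **The Laplacian of the quadratic profile at a site**, bounded below by the radial margin of `…HcpHardyWeight`: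
for `a, h > 0` and a site `x` that is neither the root nor one of its first-shell neighbours (`x ≠ 0`, `x_s ≠ 0`),
`Σ_{s ∈ shell} (‖y_x‖⁻⁶ + ‖y_{x_s}‖⁻⁶)(‖y_x‖² − ‖y_{x_s}‖²) ≥ ‖y_x‖⁻⁶ κ(a,h,‖y_x‖)`. [folklore] -/
theorem hcpSite_laplacian_ge {a h : ℝ} (ha : 0 < a) (hh : 0 < h) {x : ℤ × ℤ × ℤ} (hx : x ≠ 0)
    (hxs : ∀ s ∈ hcpStarIdx, x + (if Even x.1 then s else -s) ≠ 0) :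
    ((‖hcpSite a h x‖ ^ 2) ^ 3)⁻¹ *
        (3 * min (16 * a ^ 2) (24 * h ^ 2) - 16 * a ^ 2 - 12 * h ^ 2 -
          (72 * max (3 * a ^ 4 + a ^ 2 * (a ^ 2 / 3 + h ^ 2)) (6 * (a ^ 2 / 3 + h ^ 2) * h ^ 2) - 18 * a ^ 4 -
              18 * (a ^ 2 / 3 + h ^ 2) ^ 2) / ‖hcpSite a h x‖ ^ 2 -
          8 * √3 * a ^ 3 / ‖hcpSite a h x‖ - 36 * (a ^ 6 + (a ^ 2 / 3 + h ^ 2) ^ 3) / ‖hcpSite a h x‖ ^ 4) ≤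
      ∑ s ∈ hcpStarIdx, (((‖hcpSite a h x‖ ^ 2) ^ 3)⁻¹ + ((‖hcpSite a h (x + (if Even x.1 then s else -s))‖ ^ 2) ^ 3)⁻¹) *
        (‖hcpSite a h x‖ ^ 2 - ‖hcpSite a h (x + (if Even x.1 then s else -s))‖ ^ 2) := by
  have hpos : ∀ {v : ℤ × ℤ × ℤ}, v ≠ 0 → hcpSite a h v ≠ 0 := fun {v} hv h0 => by
    have := h1_norm_ge ha hh hv
    rw [h0, norm_zero] at this
    exact absurd this (not_le.2 (lt_min ha hh))
  -- z = ± y_x has the same norm and ‖z + y_s‖ = ‖y_{x_s}‖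
  set z : EuclideanSpace ℝ (Fin 3) := if Even x.1 then hcpSite a h x else -hcpSite a h x with hzdef
  have hzn : ‖z‖ = ‖hcpSite a h x‖ := by rw [hzdef]; split_ifs <;> simp [norm_neg]
  have hz : z ≠ 0 := by
    have hyx := hpos hx
    rw [hzdef]; split_ifs
    · exact hyx
    · exact neg_ne_zero.2 hyx
  have hbond : ∀ s, ‖hcpSite a h (x + (if Even x.1 then s else -s))‖ ^ 2 = ‖z + hcpSite a h s‖ ^ 2 := fun s => by
    rw [hcpBond_norm_sq a h x s]
  have hzs : ∀ s ∈ hcpStarIdx, z + hcpSite a h s ≠ 0 := by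
    intro s hs h0
    have e := hbond s
    rw [h0, norm_zero, zero_pow two_ne_zero, pow_eq_zero_iff two_ne_zero, norm_eq_zero] at e
    exact hpos (hxs s hs) e
  have key := hcpHardyWeight_margin ha hh z hz hzs
  rw [hzn] at key
  refine key.trans (le_of_eq (Finset.sum_congr rfl fun s _ => ?_))
  rw [hbond s]

/-! ## Summation by parts over oriented bonds -/

/-- **Reversal symmetry of oriented bonds inside `V`.**  For any `G`, summing `G(x, x_s)` over the oriented bonds with both
ends in `V` equals summing `G(x_s, x)`: the map `(x, s) ↦ (x_s, τ s)` is an involution of that set of bonds. [folklore] -/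
theorem hcpBond_sum_swap (V : Finset (ℤ × ℤ × ℤ)) (G : (ℤ × ℤ × ℤ) → (ℤ × ℤ × ℤ) → ℝ) :
    ∑ x ∈ V, ∑ s ∈ hcpStarIdx,
        (if x + (if Even x.1 then s else -s) ∈ V then G x (x + (if Even x.1 then s else -s)) else 0) =
      ∑ x ∈ V, ∑ s ∈ hcpStarIdx,
        (if x + (if Even x.1 then s else -s) ∈ V then G (x + (if Even x.1 then s else -s)) x else 0) := by
  classical
  -- oriented bonds as pairs (x, s); the set of bonds with both ends in V
  set nb : (ℤ × ℤ × ℤ) × (ℤ × ℤ × ℤ) → ℤ × ℤ × ℤ := fun p => p.1 + (if Even p.1.1 then p.2 else -p.2) with hnb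
  set Φ : (ℤ × ℤ × ℤ) × (ℤ × ℤ × ℤ) → (ℤ × ℤ × ℤ) × (ℤ × ℤ × ℤ) :=
    fun p => (nb p, if p.2.1 = 0 then -p.2 else p.2) with hΦ
  set S' := (V ×ˢ hcpStarIdx).filter (fun p => nb p ∈ V) with hS'
  have hinv : ∀ p ∈ S', Φ (Φ p) = p := by
    intro p hp
    obtain ⟨hpS, -⟩ := Finset.mem_filter.1 hp
    have hs : p.2 ∈ hcpStarIdx := (Finset.mem_product.1 hpS).2
    have h1 : nb (Φ p) = p.1 := by
      simp only [hΦ, hnb]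
      exact hcpBond_invol p.1 hs
    ext1
    · simpa only [hΦ] using h1
    · simp only [hΦ]
      exact hcpStar_tau_tau p.2
  have hmaps : ∀ p ∈ S', Φ p ∈ S' := by
    intro p hp
    obtain ⟨hpS, hpV⟩ := Finset.mem_filter.1 hp
    obtain ⟨hx, hs⟩ := Finset.mem_product.1 hpS
    have h1 : nb (Φ p) = p.1 := by
      simp only [hΦ, hnb]
      exact hcpBond_invol p.1 hs
    refine Finset.mem_filter.2 ⟨Finset.mem_product.2 ⟨?_, ?_⟩, ?_⟩
    · simpa only [hΦ] using hpV
    · simp only [hΦ]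
      exact hcpStar_tau_mem hs
    · rw [h1]; exact hx
  -- both sides as sums over S'
  have hL : ∑ x ∈ V, ∑ s ∈ hcpStarIdx,
      (if x + (if Even x.1 then s else -s) ∈ V then G x (x + (if Even x.1 then s else -s)) else 0) =
      ∑ p ∈ S', G p.1 (nb p) := by
    rw [hS', Finset.sum_filter, Finset.sum_product]
  have hR : ∑ x ∈ V, ∑ s ∈ hcpStarIdx,
      (if x + (if Even x.1 then s else -s) ∈ V then G (x + (if Even x.1 then s else -s)) x else 0) =
      ∑ p ∈ S', G (nb p) p.1 := by
    rw [hS', Finset.sum_filter, Finset.sum_product]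
  rw [hL, hR]
  -- reindex the right-hand side by the involution
  refine (Finset.sum_nbij' Φ Φ hmaps hmaps hinv hinv fun p hp => ?_)
  obtain ⟨hpS, -⟩ := Finset.mem_filter.1 hp
  have hs : p.2 ∈ hcpStarIdx := (Finset.mem_product.1 hpS).2
  have h1 : nb (Φ p) = p.1 := by
    simp only [hΦ, hnb]
    exact hcpBond_invol p.1 hs
  rw [h1]

/-! ## The Hardy inequality -/

/-- **Discrete weighted Hardy inequality on the hcp exterior.**  Let `a, h > 0`, `f : ℤ³ → ℝ` a lattice field and `V` a finite set
of indices containing every `x` with `f x ≠ 0` together with its twelve neighbours `x_s`; suppose `f` vanishes at the root and on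
its first shell (`x ≠ 0`, `x_s ≠ 0` wherever `f x ≠ 0`) and that the radial margin of `…HcpHardyWeight` is at least `κ₀` wherever
`f ≠ 0`.  Then `κ₀ Σ_{x∈V} ‖y_x‖⁻⁸ f(x)² ≤ Σ_{x∈V} ‖y_x‖⁻⁶ Σ_s (f(x_s) − f(x))²`. [folklore] -/
theorem hcpExterior_hardy {a h : ℝ} (ha : 0 < a) (hh : 0 < h) (f : ℤ × ℤ × ℤ → ℝ) (V : Finset (ℤ × ℤ × ℤ)) (κ₀ : ℝ)
    (hV : ∀ x, f x ≠ 0 → x ∈ V ∧ ∀ s ∈ hcpStarIdx, x + (if Even x.1 then s else -s) ∈ V)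
    (hfar : ∀ x, f x ≠ 0 → x ≠ 0 ∧ ∀ s ∈ hcpStarIdx, x + (if Even x.1 then s else -s) ≠ 0)
    (hκ : ∀ x, f x ≠ 0 → κ₀ ≤
      3 * min (16 * a ^ 2) (24 * h ^ 2) - 16 * a ^ 2 - 12 * h ^ 2 -
          (72 * max (3 * a ^ 4 + a ^ 2 * (a ^ 2 / 3 + h ^ 2)) (6 * (a ^ 2 / 3 + h ^ 2) * h ^ 2) - 18 * a ^ 4 -
              18 * (a ^ 2 / 3 + h ^ 2) ^ 2) / ‖hcpSite a h x‖ ^ 2 -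
          8 * √3 * a ^ 3 / ‖hcpSite a h x‖ - 36 * (a ^ 6 + (a ^ 2 / 3 + h ^ 2) ^ 3) / ‖hcpSite a h x‖ ^ 4) :
    κ₀ * ∑ x ∈ V, ((‖hcpSite a h x‖ ^ 2) ^ 4)⁻¹ * f x ^ 2 ≤
      ∑ x ∈ V, ((‖hcpSite a h x‖ ^ 2) ^ 3)⁻¹ *
        ∑ s ∈ hcpStarIdx, (f (x + (if Even x.1 then s else -s)) - f x) ^ 2 := by
  classical
  have hpos : ∀ {v : ℤ × ℤ × ℤ}, v ≠ 0 → 0 < ‖hcpSite a h v‖ := fun {v} hv =>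
    lt_of_lt_of_le (lt_min ha hh) (h1_norm_ge ha hh hv)
  -- abbreviations: φ = ‖y‖², c = φ⁻³, x_s
  set φ : ℤ × ℤ × ℤ → ℝ := fun x => ‖hcpSite a h x‖ ^ 2 with hφ
  set c : ℤ × ℤ × ℤ → ℝ := fun x => ((‖hcpSite a h x‖ ^ 2) ^ 3)⁻¹ with hc
  have hφ0 : ∀ x, 0 ≤ φ x := fun x => by positivity
  have hc0 : ∀ x, 0 ≤ c x := fun x => by positivity
  have hφf : ∀ x, f x ≠ 0 → 0 < φ x := fun x hx => by
    have := hpos (hfar x hx).1; positivity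
  -- Step 1: bond by bond, the ground-state inequality
  have step1 : ∀ x ∈ V, ∀ s ∈ hcpStarIdx,
      c x * (φ x - φ (x + (if Even x.1 then s else -s))) *
          (f x ^ 2 / φ x - f (x + (if Even x.1 then s else -s)) ^ 2 / φ (x + (if Even x.1 then s else -s))) ≤
        c x * (f (x + (if Even x.1 then s else -s)) - f x) ^ 2 := by
    intro x _ s _
    have e : (f (x + (if Even x.1 then s else -s)) - f x) ^ 2 = (f x - f (x + (if Even x.1 then s else -s))) ^ 2 := by ring
    rw [e]
    exact groundState_edge_le (hc0 x) (hφ0 _) (hφ0 _) (hφf _) (hφf _)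
  have hRHS : ∑ x ∈ V, ∑ s ∈ hcpStarIdx, c x * (φ x - φ (x + (if Even x.1 then s else -s))) *
        (f x ^ 2 / φ x - f (x + (if Even x.1 then s else -s)) ^ 2 / φ (x + (if Even x.1 then s else -s))) ≤
      ∑ x ∈ V, c x * ∑ s ∈ hcpStarIdx, (f (x + (if Even x.1 then s else -s)) - f x) ^ 2 := by
    refine Finset.sum_le_sum fun x hx => ?_
    rw [Finset.mul_sum]
    exact Finset.sum_le_sum fun s hs => step1 x hx s hs
  refine le_trans ?_ hRHS
  -- Step 2: split into the two endpoint parts and reverse the bonds of the second one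
  have hsplit : ∀ x ∈ V, ∀ s ∈ hcpStarIdx,
      c x * (φ x - φ (x + (if Even x.1 then s else -s))) *
          (f x ^ 2 / φ x - f (x + (if Even x.1 then s else -s)) ^ 2 / φ (x + (if Even x.1 then s else -s))) =
        f x ^ 2 / φ x * (c x * (φ x - φ (x + (if Even x.1 then s else -s)))) -
          (if x + (if Even x.1 then s else -s) ∈ V then
            c x * (φ x - φ (x + (if Even x.1 then s else -s))) *
              (f (x + (if Even x.1 then s else -s)) ^ 2 / φ (x + (if Even x.1 then s else -s)))
           else 0) := by
    intro x _ s hs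
    by_cases hmem : x + (if Even x.1 then s else -s) ∈ V
    · rw [if_pos hmem]; ring
    · -- the far end is outside V, so f vanishes there
      have : f (x + (if Even x.1 then s else -s)) = 0 := by
        by_contra hne; exact hmem (hV _ hne).1
      rw [if_neg hmem, this]; ring
  have hswap := hcpBond_sum_swap V (fun x y => c x * (φ x - φ y) * (f y ^ 2 / φ y))
  -- after reversal, the second part reads f_x²/φ_x · c_{x_s} (φ_{x_s} − φ_x), and the indicator can be dropped again
  have hback : ∀ x ∈ V, ∀ s ∈ hcpStarIdx,
      (if x + (if Even x.1 then s else -s) ∈ V then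
          c (x + (if Even x.1 then s else -s)) * (φ (x + (if Even x.1 then s else -s)) - φ x) * (f x ^ 2 / φ x)
        else 0) =
        f x ^ 2 / φ x * (c (x + (if Even x.1 then s else -s)) * (φ (x + (if Even x.1 then s else -s)) - φ x)) := by
    intro x _ s hs
    by_cases hmem : x + (if Even x.1 then s else -s) ∈ V
    · rw [if_pos hmem]; ring
    · have : f x = 0 := by
        by_contra hne; exact hmem ((hV x hne).2 s hs)
      rw [if_neg hmem, this]; ring
  have hmid : ∑ x ∈ V, ∑ s ∈ hcpStarIdx, c x * (φ x - φ (x + (if Even x.1 then s else -s))) *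
        (f x ^ 2 / φ x - f (x + (if Even x.1 then s else -s)) ^ 2 / φ (x + (if Even x.1 then s else -s))) =
      ∑ x ∈ V, f x ^ 2 / φ x * ∑ s ∈ hcpStarIdx,
        (c x + c (x + (if Even x.1 then s else -s))) * (φ x - φ (x + (if Even x.1 then s else -s))) := by
    calc _ = ∑ x ∈ V, ∑ s ∈ hcpStarIdx, (f x ^ 2 / φ x * (c x * (φ x - φ (x + (if Even x.1 then s else -s)))) -
          (if x + (if Even x.1 then s else -s) ∈ V then
            c x * (φ x - φ (x + (if Even x.1 then s else -s))) *
              (f (x + (if Even x.1 then s else -s)) ^ 2 / φ (x + (if Even x.1 then s else -s)))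
           else 0)) := Finset.sum_congr rfl fun x hx => Finset.sum_congr rfl fun s hs => hsplit x hx s hs
      _ = ∑ x ∈ V, ∑ s ∈ hcpStarIdx, f x ^ 2 / φ x * (c x * (φ x - φ (x + (if Even x.1 then s else -s)))) -
          ∑ x ∈ V, ∑ s ∈ hcpStarIdx, (if x + (if Even x.1 then s else -s) ∈ V then
            c x * (φ x - φ (x + (if Even x.1 then s else -s))) *
              (f (x + (if Even x.1 then s else -s)) ^ 2 / φ (x + (if Even x.1 then s else -s)))
           else 0) := by
          rw [← Finset.sum_sub_distrib]
          exact Finset.sum_congr rfl fun x _ => Finset.sum_sub_distrib _ _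
      _ = ∑ x ∈ V, ∑ s ∈ hcpStarIdx, f x ^ 2 / φ x * (c x * (φ x - φ (x + (if Even x.1 then s else -s)))) -
          ∑ x ∈ V, ∑ s ∈ hcpStarIdx, f x ^ 2 / φ x *
            (c (x + (if Even x.1 then s else -s)) * (φ (x + (if Even x.1 then s else -s)) - φ x)) := by
          rw [hswap]
          congr 1
          exact Finset.sum_congr rfl fun x hx => Finset.sum_congr rfl fun s hs => hback x hx s hs
      _ = _ := by
          rw [← Finset.sum_sub_distrib]
          refine Finset.sum_congr rfl fun x _ => ?_
          rw [← Finset.sum_sub_distrib, Finset.mul_sum]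
          exact Finset.sum_congr rfl fun s _ => by ring
  rw [hmid]
  -- Step 3: sitewise, the Laplacian of the profile dominates κ₀ φ⁻³ (where f ≠ 0)
  rw [Finset.mul_sum]
  refine Finset.sum_le_sum fun x _ => ?_
  by_cases hfx : f x = 0
  · simp [hfx]
  · obtain ⟨hx0, hxs⟩ := hfar x hfx
    have hlap := hcpSite_laplacian_ge ha hh hx0 hxs
    have hq : 0 ≤ f x ^ 2 / φ x := by positivity
    have hκx := hκ x hfx
    have hφx : 0 < φ x := hφf x hfx
    calc κ₀ * (((‖hcpSite a h x‖ ^ 2) ^ 4)⁻¹ * f x ^ 2)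
        = f x ^ 2 / φ x * (((‖hcpSite a h x‖ ^ 2) ^ 3)⁻¹ * κ₀) := by
          simp only [hφ]; field_simp
      _ ≤ f x ^ 2 / φ x * (((‖hcpSite a h x‖ ^ 2) ^ 3)⁻¹ *
          (3 * min (16 * a ^ 2) (24 * h ^ 2) - 16 * a ^ 2 - 12 * h ^ 2 -
            (72 * max (3 * a ^ 4 + a ^ 2 * (a ^ 2 / 3 + h ^ 2)) (6 * (a ^ 2 / 3 + h ^ 2) * h ^ 2) - 18 * a ^ 4 -
                18 * (a ^ 2 / 3 + h ^ 2) ^ 2) / ‖hcpSite a h x‖ ^ 2 -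
            8 * √3 * a ^ 3 / ‖hcpSite a h x‖ - 36 * (a ^ 6 + (a ^ 2 / 3 + h ^ 2) ^ 3) / ‖hcpSite a h x‖ ^ 4)) :=
          mul_le_mul_of_nonneg_left (mul_le_mul_of_nonneg_left hκx (by positivity)) hq
      _ ≤ f x ^ 2 / φ x * ∑ s ∈ hcpStarIdx,
          (c x + c (x + (if Even x.1 then s else -s))) * (φ x - φ (x + (if Even x.1 then s else -s))) :=
          mul_le_mul_of_nonneg_left (by simpa only [hc, hφ] using hlap) hq

/-- **Vector version** (coordinatewise): the same inequality for `v : ℤ³ → ℝ³` with `‖v(x_s) − v(x)‖²` on the right and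
`‖v(x)‖²` on the left. [folklore] -/
theorem hcpExterior_hardy_vec {a h : ℝ} (ha : 0 < a) (hh : 0 < h) (v : ℤ × ℤ × ℤ → EuclideanSpace ℝ (Fin 3))
    (V : Finset (ℤ × ℤ × ℤ)) (κ₀ : ℝ)
    (hV : ∀ x, v x ≠ 0 → x ∈ V ∧ ∀ s ∈ hcpStarIdx, x + (if Even x.1 then s else -s) ∈ V)
    (hfar : ∀ x, v x ≠ 0 → x ≠ 0 ∧ ∀ s ∈ hcpStarIdx, x + (if Even x.1 then s else -s) ≠ 0)
    (hκ : ∀ x, v x ≠ 0 → κ₀ ≤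
      3 * min (16 * a ^ 2) (24 * h ^ 2) - 16 * a ^ 2 - 12 * h ^ 2 -
          (72 * max (3 * a ^ 4 + a ^ 2 * (a ^ 2 / 3 + h ^ 2)) (6 * (a ^ 2 / 3 + h ^ 2) * h ^ 2) - 18 * a ^ 4 -
              18 * (a ^ 2 / 3 + h ^ 2) ^ 2) / ‖hcpSite a h x‖ ^ 2 -
          8 * √3 * a ^ 3 / ‖hcpSite a h x‖ - 36 * (a ^ 6 + (a ^ 2 / 3 + h ^ 2) ^ 3) / ‖hcpSite a h x‖ ^ 4) :
    κ₀ * ∑ x ∈ V, ((‖hcpSite a h x‖ ^ 2) ^ 4)⁻¹ * ‖v x‖ ^ 2 ≤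
      ∑ x ∈ V, ((‖hcpSite a h x‖ ^ 2) ^ 3)⁻¹ *
        ∑ s ∈ hcpStarIdx, ‖v (x + (if Even x.1 then s else -s)) - v x‖ ^ 2 := by
  have hn : ∀ z : EuclideanSpace ℝ (Fin 3), ‖z‖ ^ 2 = ∑ i, z i ^ 2 := fun z => by
    rw [EuclideanSpace.norm_eq, Real.sq_sqrt (Finset.sum_nonneg fun i _ => sq_nonneg _)]
    exact Finset.sum_congr rfl fun i _ => by rw [Real.norm_eq_abs, sq_abs]
  have hne : ∀ x i, v x i ≠ 0 → v x ≠ 0 := fun x i hi hv => hi (by rw [hv]; rfl)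
  have hsc : ∀ i, κ₀ * ∑ x ∈ V, ((‖hcpSite a h x‖ ^ 2) ^ 4)⁻¹ * (v x i) ^ 2 ≤
      ∑ x ∈ V, ((‖hcpSite a h x‖ ^ 2) ^ 3)⁻¹ *
        ∑ s ∈ hcpStarIdx, (v (x + (if Even x.1 then s else -s)) i - v x i) ^ 2 := fun i =>
    hcpExterior_hardy ha hh (fun x => v x i) V κ₀ (fun x hx => hV x (hne x i hx)) (fun x hx => hfar x (hne x i hx))
      (fun x hx => hκ x (hne x i hx))
  calc κ₀ * ∑ x ∈ V, ((‖hcpSite a h x‖ ^ 2) ^ 4)⁻¹ * ‖v x‖ ^ 2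
      = ∑ i, κ₀ * ∑ x ∈ V, ((‖hcpSite a h x‖ ^ 2) ^ 4)⁻¹ * (v x i) ^ 2 := by
        rw [← Finset.mul_sum, Finset.sum_comm]
        congr 1
        exact Finset.sum_congr rfl fun x _ => by rw [hn (v x), Finset.mul_sum]
    _ ≤ ∑ i, ∑ x ∈ V, ((‖hcpSite a h x‖ ^ 2) ^ 3)⁻¹ *
          ∑ s ∈ hcpStarIdx, (v (x + (if Even x.1 then s else -s)) i - v x i) ^ 2 := Finset.sum_le_sum fun i _ => hsc i
    _ = ∑ x ∈ V, ((‖hcpSite a h x‖ ^ 2) ^ 3)⁻¹ *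
          ∑ s ∈ hcpStarIdx, ‖v (x + (if Even x.1 then s else -s)) - v x‖ ^ 2 := by
        rw [Finset.sum_comm]
        refine Finset.sum_congr rfl fun x _ => ?_
        rw [← Finset.mul_sum, Finset.sum_comm]
        congr 1
        exact Finset.sum_congr rfl fun s _ => by
          rw [hn (v _ - v x)]; exact Finset.sum_congr rfl fun i _ => by rw [PiLp.sub_apply]

end Summit.AtomisticToContinuum.Crystallization.Theorems.StrictSplittingRuleBirth

end
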